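import Literature.Probability.LatticeModels.ShiftLemma
import Literature.Probability.LatticeModels.CoexistenceTransport
import Literature.Probability.LatticeModels.MinusFrame
import Literature.Probability.LatticeModels.BadPercolationEnclosure
import Literature.Probability.LatticeModels.TailTrivialMixing
import Mathlib.Dynamics.Ergodic.Conservative
import HarnessLib

/-!
# Orthogonal butterflies, the core argument (Georgii–Higuchi 2000, Lemma 4.3)

Topic `Probability/LatticeModels`. Georgii–Higuchi 2000, proof of Lemma 4.3 (p. 1158): "Suppose
there exists some `μ ∈ 𝒢` having almost surely no vertical infinite butterfly. … `μ` is in fact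
ergodic under `þ²_hor`. By the butterfly lemma, horizontal infinite butterflies do exist, say of
colour `+`. … Fix any `n ≥ 1`. For `k ∈ ℤ` let `A_k` denote the event that all spins along the
straight path `p_{k,n} = ((k,l) : l = -n, …, n)` are `+1`, `(k, n)` belongs to an infinite `+`cluster
in `π_{n,up} = {x₂ ≥ n}`, and `(k, -n)` belongs to an infinite `+`cluster in `π_{n,down}`. Let `A` be
the event that `A_k` occurs for infinitely many `k < 0` and infinitely many `k > 0`. The finite
energy property then shows that `μ(A_0) > 0`, and the horizontal ergodicity and Poincaré's
recurrence theorem imply that `μ(A) = 1`. But the line touching lemma guarantees that the infinitely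
many doubly-infinite `vertical' `+`paths passing through the horizontal axis are connected to each
other in `π_{n,up}` and `π_{n,down}`. As `n` was arbitrary, it follows that almost surely each finite
set is surrounded by a `+`circuit, and an infinite `-`cluster cannot exist."

We formalise this argument with the signs interchanged (`-`columns and `-`hooks kill the
`+`clusters) for a tail-trivial `μ ∈ 𝒢(β, 0)`, `β > β_c(2)`, invariant under some horizontal shift
`θ_{t e₁}`, `t ≠ 0`, whose upper and lower half-planes both contain infinite `+` and `-` clusters
(the lower half-plane data are phrased for the reflected measure `μ ∘ R⁻¹`, `R(x₁,x₂) = (x₁,-x₂)`).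
The coexistence of both colours in the half-planes is what the application provides (flip-reflection
symmetry in the absence of vertical butterflies) and lets us use the uniqueness of the infinite
`-`clusters of `{x₂ ≥ n}` in the form `ae_minus_cluster_unique` (line touching lemma).
Ingredients: shift lemma (`shift_lemma_up_level`), finite energy
(`IsGibbsMeasure.mul_measure_glueWith_preimage_le`), Poincaré recurrence
(`MeasureTheory.Conservative.ae_mem_imp_frequently_image_mem`), ergodicity of tail-trivial invariant
measures (`IsTailTrivial.measure_eq_zero_or_one_of_shift_invariant`), and the frame lemma
(`siteCluster_plus_finite_of_minusFrame`).

Main result: **`measure_existsInfCluster_plus_eq_zero_of_shift_invariant`**.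

## References

* H.-O. Georgii, Y. Higuchi, *Percolation and number of phases in the two-dimensional Ising
  model*, J. Math. Phys. 41 (2000), Lemma 4.3 [GeorgiiHiguchi2000].
-/

noncomputable section

open MeasureTheory Filter SimpleGraph
open Literature.Probability.Percolation
open scoped ENNReal

namespace Literature.Probability.LatticeModels

/-! ### Clusters of shifted configurations, pointwise -/

section Shift

/-- The lattice clusters of a shifted configuration are the shifted clusters. [folklore] -/
theorem siteCluster_configShift_eq_image_lattice (s : ℤˣ) (u : Site 2) (k : ℤ) (ω : SpinConfig (Site 2)) (y : Site 2) :
    siteCluster (zdGraph 2) (spinSites s (configShift u ω) ∩ halfPlane k) (y + u) =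
      (fun z : Site 2 => z + u) '' siteCluster (zdGraph 2) (spinSites s ω ∩ halfPlane (k - u 1)) y := by
  set φ := zdShiftIso (d := 2) u with hφ
  have hcfg : (configShift (S := ℤˣ) u ω : SpinConfig (Site 2)) = configRelabel φ.toEquiv ω := rfl
  have himg : (φ : Site 2 → Site 2) '' (spinSites s ω ∩ halfPlane (k - u 1)) =
      (φ : Site 2 → Site 2) '' spinSites s ω ∩ halfPlane k := by
    ext z
    simp only [Set.mem_image, Set.mem_inter_iff, halfPlane, Set.mem_setOf_eq, hφ, zdShiftIso_apply]
    constructor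
    · rintro ⟨y, ⟨hy, hy1⟩, rfl⟩
      exact ⟨⟨y, hy, rfl⟩, by simp; omega⟩
    · rintro ⟨⟨y, hy, rfl⟩, hz1⟩
      refine ⟨y, ⟨hy, ?_⟩, rfl⟩
      simp at hz1; omega
  have hO : spinSites s (configShift (S := ℤˣ) u ω) ∩ halfPlane k =
      (φ : Site 2 → Site 2) '' (spinSites s ω ∩ halfPlane (k - u 1)) := by
    rw [hcfg, spinSites_configRelabel, himg]; rfl
  have key : siteCluster (zdGraph 2) ((φ : Site 2 → Site 2) '' (spinSites s ω ∩ halfPlane (k - u 1))) (φ y) =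
      (φ : Site 2 → Site 2) '' siteCluster (zdGraph 2) (spinSites s ω ∩ halfPlane (k - u 1)) y := by
    have h := siteCluster_relabel φ (spinSites s ω ∩ halfPlane (k - u 1)) y
    rwa [SiteConfig.relabel_apply] at h
  rw [hO, show y + u = φ y from rfl, key]
  rfl

/-- The `∗`-clusters of a shifted configuration are the shifted clusters. [folklore] -/
theorem siteCluster_configShift_eq_image_star (s : ℤˣ) (u : Site 2) (k : ℤ) (ω : SpinConfig (Site 2)) (y : Site 2) :
    siteCluster zdStarGraph (spinSites s (configShift u ω) ∩ halfPlane k) (y + u) =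
      (fun z : Site 2 => z + u) '' siteCluster zdStarGraph (spinSites s ω ∩ halfPlane (k - u 1)) y := by
  set φ := starShiftIso u with hφ
  have hcfg : (configShift (S := ℤˣ) u ω : SpinConfig (Site 2)) = configRelabel φ.toEquiv ω := rfl
  have himg : (φ : Site 2 → Site 2) '' (spinSites s ω ∩ halfPlane (k - u 1)) =
      (φ : Site 2 → Site 2) '' spinSites s ω ∩ halfPlane k := by
    ext z
    simp only [Set.mem_image, Set.mem_inter_iff, halfPlane, Set.mem_setOf_eq, hφ, starShiftIso_apply]
    constructor
    · rintro ⟨y, ⟨hy, hy1⟩, rfl⟩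
      exact ⟨⟨y, hy, rfl⟩, by simp; omega⟩
    · rintro ⟨⟨y, hy, rfl⟩, hz1⟩
      refine ⟨y, ⟨hy, ?_⟩, rfl⟩
      simp at hz1; omega
  have hO : spinSites s (configShift (S := ℤˣ) u ω) ∩ halfPlane k =
      (φ : Site 2 → Site 2) '' (spinSites s ω ∩ halfPlane (k - u 1)) := by
    rw [hcfg, spinSites_configRelabel, himg]; rfl
  have key : siteCluster zdStarGraph ((φ : Site 2 → Site 2) '' (spinSites s ω ∩ halfPlane (k - u 1))) (φ y) =
      (φ : Site 2 → Site 2) '' siteCluster zdStarGraph (spinSites s ω ∩ halfPlane (k - u 1)) y := by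
    have h := siteCluster_relabel φ (spinSites s ω ∩ halfPlane (k - u 1)) y
    rwa [SiteConfig.relabel_apply] at h
  rw [hO, show y + u = φ y from rfl, key]
  rfl

/-- Iterates of a shift. [folklore] -/
theorem configShift_single_iterate (c : ℤ) (j : ℕ) (ω : SpinConfig (Site 2)) :
    (⇑(configShift (S := ℤˣ) (Pi.single (0 : Fin 2) c : Site 2)))^[j] ω =
      configShift (Pi.single (0 : Fin 2) ((j : ℤ) * c) : Site 2) ω := by
  induction j generalizing ω with
  | zero =>
    rw [Function.iterate_zero, id_eq]
    ext z
    rw [configShift_apply]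
    simp
  | succ j ih =>
    rw [Function.iterate_succ_apply', ih]
    have : (Pi.single (0 : Fin 2) (((j + 1 : ℕ) : ℤ) * c) : Site 2) = Pi.single 0 c + Pi.single 0 ((j : ℤ) * c) := by
      rw [← Pi.single_add]; congr 1; push_cast; ring
    rw [this, configShift_add_eq_comp]; rfl

/-- The reflection `R(x₁, x₂) = (x₁, -x₂)` commutes with horizontal shifts of the configuration. [folklore] -/
theorem configRelabel_reflectOne_configShift_single_zero (j : ℤ) (ω : SpinConfig (Site 2)) :
    configRelabel (reflectCoord (d := 2) 1).toEquiv (configShift (Pi.single (0 : Fin 2) j : Site 2) ω) =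
      configShift (Pi.single (0 : Fin 2) j : Site 2) (configRelabel (reflectCoord (d := 2) 1).toEquiv ω) := by
  have h := congrFun (configRelabel_reflectCoord_one_comp_configShift (Pi.single (0 : Fin 2) j : Site 2)) ω
  simp only [Function.comp_apply] at h
  have hR : reflectCoord 1 (Pi.single (0 : Fin 2) j : Site 2) = Pi.single 0 j := by
    funext i; rw [reflectCoord_apply]; fin_cases i <;> simp
  rw [h, hR]

/-- The reflection `R` commutes with gluing a square box to a constant. [folklore] -/
theorem configRelabel_reflectOne_glueWith_box (N : ℕ) (τ : ℤˣ) (η : SpinConfig (Site 2)) :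
    configRelabel (reflectCoord (d := 2) 1).toEquiv (glueWith (box 2 N) (fun _ => τ) η) =
      glueWith (box 2 N) (fun _ => τ) (configRelabel (reflectCoord (d := 2) 1).toEquiv η) := by
  classical
  funext z
  by_cases hz : z ∈ box 2 N
  · have hRz : reflectCoord 1 z ∈ box 2 N := (reflectCoord_mem_box_iff 1 N z).2 hz
    rw [configRelabel_apply, reflectCoord_symm_apply, glueWith_apply_mem _ _ _ hRz, glueWith_apply_mem _ _ _ hz]
  · have hRz : reflectCoord 1 z ∉ box 2 N := fun h => hz ((reflectCoord_mem_box_iff 1 N z).1 h)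
    rw [configRelabel_apply, reflectCoord_symm_apply, glueWith_apply_not_mem _ _ _ hRz,
      glueWith_apply_not_mem _ _ _ hz, configRelabel_apply, reflectCoord_symm_apply]

end Shift

/-! ### The main theorem -/

section Main

variable {β : ℝ} {μ : Measure (SpinConfig (Site 2))}

/-- **Georgii–Higuchi 2000, Lemma 4.3 (core argument, signs interchanged).** Let `β > β_c(2)` and
let `μ ∈ 𝒢(β, 0)` be tail trivial and invariant under a horizontal shift `θ_{t e₁}`, `t ≠ 0`.
Suppose that, almost surely, the upper half-plane contains an infinite `+`cluster and an infinite
`-`cluster, and the same holds for the reflected measure `μ ∘ R⁻¹` (i.e. for the lower half-plane).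
Then `μ(E⁺) = 0`: almost surely there is no infinite `+`cluster in `ℤ²`. (In the application `μ`
also has `μ(E⁺) = 1` by coexistence, a contradiction: this is how "an infinite `-`cluster cannot
exist" concludes the printed proof.) [cite: GeorgiiHiguchi2000, Lemma 4.3] -/
theorem measure_existsInfCluster_plus_eq_zero_of_shift_invariant (hβc : criticalBeta 2 < β)
    (hμ : μ ∈ isingGibbsMeasures 2 β 0) (hμt : IsTailTrivial μ) {t : ℤ} (ht : t ≠ 0)
    (hinv : μ.map (configShift (Pi.single (0 : Fin 2) t : Site 2)) = μ)
    (hP : ∀ᵐ ω ∂μ, ∃ x, (siteCluster (zdGraph 2) (spinSites 1 ω ∩ halfPlane 0) x).Infinite)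
    (hM : ∀ᵐ ω ∂μ, ∃ y, (siteCluster (zdGraph 2) (spinSites (-1) ω ∩ halfPlane 0) y).Infinite)
    (hP' : ∀ᵐ ω ∂(μ.map (configRelabel (reflectCoord (d := 2) 1).toEquiv)),
      ∃ x, (siteCluster (zdGraph 2) (spinSites 1 ω ∩ halfPlane 0) x).Infinite)
    (hM' : ∀ᵐ ω ∂(μ.map (configRelabel (reflectCoord (d := 2) 1).toEquiv)),
      ∃ y, (siteCluster (zdGraph 2) (spinSites (-1) ω ∩ halfPlane 0) y).Infinite) :
    μ (existsInfCluster (zdGraph 2) 1) = 0 := by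
  classical
  have hμG : IsGibbsMeasure (isingSpecification (zdGraph 2) β 0) μ := hμ
  haveI := hμG.isProbabilityMeasure
  set ρ : SpinConfig (Site 2) → SpinConfig (Site 2) := ⇑(configRelabel (reflectCoord (d := 2) 1).toEquiv) with hρ
  have hρm : Measurable ρ := (configRelabel _).measurable
  have hμR : μ.map ρ ∈ isingGibbsMeasures 2 β 0 := IsGibbsMeasure.map_configRelabel _ (reflectCoord 1) hμG
  have hμRt : IsTailTrivial (μ.map ρ) := hμt.map_configRelabel _
  haveI : IsProbabilityMeasure (μ.map ρ) := Measure.isProbabilityMeasure_map hρm.aemeasurable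
  -- the shifts
  set θ : SpinConfig (Site 2) → SpinConfig (Site 2) := ⇑(configShift (S := ℤˣ) (Pi.single (0 : Fin 2) t : Site 2)) with hθ
  have hθm : Measurable θ := (configShift _).measurable
  have hmp : MeasurePreserving θ μ μ := ⟨hθm, hinv⟩
  have hinv' : μ.map (configShift (S := ℤˣ) (Pi.single (0 : Fin 2) (-t) : Site 2)) = μ := by
    have hneg : (Pi.single (0 : Fin 2) (-t) : Site 2) = -Pi.single 0 t := by
      ext i; fin_cases i <;> simp
    rw [hneg]
    conv_lhs => rw [← hinv]
    rw [Measure.map_map (configShift _).measurable hθm, hθ, configShift_neg_comp, Measure.map_id]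
  have hmp' : MeasurePreserving (⇑(configShift (S := ℤˣ) (Pi.single (0 : Fin 2) (-t) : Site 2))) μ μ :=
    ⟨(configShift _).measurable, hinv'⟩
  -- STEP A: for every `m`, almost surely every `+`cluster meeting `[-m, m]²` is finite
  have hF : ∀ m : ℕ, ∀ᵐ ω ∂μ, ∀ u : Site 2, (-(m : ℤ) ≤ u 0 ∧ u 0 ≤ m ∧ -(m : ℤ) ≤ u 1 ∧ u 1 ≤ m) →
      (siteCluster (zdGraph 2) (spinSites 1 ω) u).Finite := by
    intro m
    set n : ℤ := (m : ℤ) + 1 with hn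
    have hcast : ((m + 1 : ℕ) : ℤ) = n := by rw [hn]; push_cast; ring
    -- the events `A_k`
    set A : ℤ → Set (SpinConfig (Site 2)) := fun k => {ω |
      (∀ l : ℤ, -n ≤ l → l ≤ n → ω ![k, l] = -1) ∧
      (siteCluster (zdGraph 2) (spinSites (-1) ω ∩ halfPlane n) ![k, n]).Infinite ∧
      (siteCluster (zdGraph 2) (spinSites (-1) (ρ ω) ∩ halfPlane n) ![k, n]).Infinite} with hA
    have hAmeas : ∀ k, MeasurableSet (A k) := by
      intro k
      have h1 : Measurable fun ω : SpinConfig (Site 2) => ∀ l : ℤ, -n ≤ l → l ≤ n → ω ![k, l] = -1 := by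
        refine Measurable.forall fun l => Measurable.imp measurable_const (Measurable.imp measurable_const ?_)
        exact measurableSet_setOf.1 (measurableSet_of_forall_eq_config (K := {![k, l]}) fun ω ω' h => by
          rw [Set.mem_setOf_eq, Set.mem_setOf_eq, h _ (Finset.mem_singleton_self _)])
      have h2 : Measurable fun ω : SpinConfig (Site 2) =>
          (siteCluster (zdGraph 2) (spinSites (-1) ω ∩ halfPlane n) ![k, n]).Infinite :=
        measurableSet_setOf.1 (measurableSet_infinite_spinCluster (-1) (halfPlane n) _)
      have h3 : Measurable fun ω : SpinConfig (Site 2) =>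
          (siteCluster (zdGraph 2) (spinSites (-1) (ρ ω) ∩ halfPlane n) ![k, n]).Infinite :=
        measurableSet_setOf.1 (hρm (measurableSet_infinite_spinCluster (-1) (halfPlane n) (![k, n])))
      exact measurableSet_setOf.2 (h1.and (h2.and h3))
    -- shifting the events
    have hshift : ∀ (j k : ℤ) (ω : SpinConfig (Site 2)), configShift (Pi.single (0 : Fin 2) j : Site 2) ω ∈ A k ↔ ω ∈ A (k - j) := by
      intro j k ω
      have hpt : ∀ l : ℤ, (![k, l] : Site 2) - Pi.single 0 j = ![k - j, l] := fun l => by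
        ext i; fin_cases i <;> simp
      have hpt' : (![k - j, n] : Site 2) + Pi.single 0 j = ![k, n] := by ext i; fin_cases i <;> simp
      have hinj : Set.InjOn (fun z : Site 2 => z + Pi.single (0 : Fin 2) j) Set.univ := fun a _ b _ h => add_right_cancel h
      have htop : ∀ σ : SpinConfig (Site 2),
          (siteCluster (zdGraph 2) (spinSites (-1) (configShift (Pi.single (0 : Fin 2) j : Site 2) σ) ∩ halfPlane n) ![k, n]).Infinite ↔
            (siteCluster (zdGraph 2) (spinSites (-1) σ ∩ halfPlane n) ![k - j, n]).Infinite := by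
        intro σ
        have h := siteCluster_configShift_eq_image_lattice (-1) (Pi.single (0 : Fin 2) j) n σ ![k - j, n]
        rw [hpt', show n - (Pi.single (0 : Fin 2) j : Site 2) 1 = n by simp] at h
        rw [h, Set.infinite_image_iff (hinj.mono (Set.subset_univ _))]
      have hbot := htop (ρ ω)
      rw [← configRelabel_reflectOne_configShift_single_zero] at hbot
      simp only [hA, Set.mem_setOf_eq, configShift_apply, hpt]
      rw [htop ω, hbot]
    -- finite energy: `μ(A_0) > 0`
    have hApos : μ (A 0) ≠ 0 := by
      have hTop : ∀ᵐ ω ∂μ, ∃ y, (siteCluster (zdGraph 2) (spinSites (-1) ω ∩ halfPlane n) y).Infinite := by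
        have h := shift_lemma_up_level hμ hμt (-1) hM (m + 1)
        rwa [hcast] at h
      have hBot : ∀ᵐ ω ∂μ, ∃ y, (siteCluster (zdGraph 2) (spinSites (-1) (ρ ω) ∩ halfPlane n) y).Infinite := by
        have h := shift_lemma_up_level hμR hμRt (-1) hM' (m + 1)
        rw [hcast] at h
        exact ae_of_ae_map hρm.aemeasurable h
      set G : ℕ → Set (SpinConfig (Site 2)) := fun N => {ω |
        (∃ z ∈ box 2 N, (siteCluster (zdGraph 2) (spinSites (-1) ω ∩ halfPlane n) z).Infinite) ∧
        (∃ z ∈ box 2 N, (siteCluster (zdGraph 2) (spinSites (-1) (ρ ω) ∩ halfPlane n) z).Infinite)} with hG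
      have hGcover : ∀ᵐ ω ∂μ, ∃ N, ω ∈ G N := by
        filter_upwards [hTop, hBot] with ω ⟨y, hy⟩ ⟨y', hy'⟩
        obtain ⟨N, hN⟩ := (eventually_subset_box_holds (d := 2) ({y, y'} : Finset (Site 2))).exists
        exact ⟨N, ⟨y, hN (by simp), hy⟩, ⟨y', hN (by simp), hy'⟩⟩
      obtain ⟨N₀, hN₀⟩ : ∃ N, μ (G N) ≠ 0 := by
        by_contra hall
        push Not at hall
        have h0 : μ (⋃ N, G N) = 0 := measure_iUnion_null hall
        rw [measure_eq_zero_iff_ae_notMem] at h0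
        have h2 : ∀ᵐ ω ∂μ, False := by
          filter_upwards [h0, hGcover] with ω h1 ⟨N, hN⟩
          exact h1 (Set.mem_iUnion.2 ⟨N, hN⟩)
        obtain ⟨ω, hω⟩ := h2.exists
        exact hω
      set N : ℕ := N₀ + (m + 1) with hNdef
      have hGN : μ (G N) ≠ 0 := by
        refine fun h => hN₀ (measure_mono_null ?_ h)
        rintro ω ⟨⟨z, hz, hz'⟩, ⟨w, hw, hw'⟩⟩
        exact ⟨⟨z, box_mono 2 (Nat.le_add_right _ _) hz, hz'⟩, ⟨w, box_mono 2 (Nat.le_add_right _ _) hw, hw'⟩⟩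
      set Λ : Finset (Site 2) := box 2 N with hΛ
      -- gluing `Λ` to `-1` produces the hooks
      have hglueTop : ∀ η : SpinConfig (Site 2),
          (∃ z ∈ box 2 N, (siteCluster (zdGraph 2) (spinSites (-1) η ∩ halfPlane n) z).Infinite) →
            (siteCluster (zdGraph 2) (spinSites (-1) (glueWith Λ (fun _ => (-1 : ℤˣ)) η) ∩ halfPlane n) ![0, n]).Infinite := by
        rintro η ⟨z, hzN, hz⟩
        have hsubO : spinSites (-1) η ∩ halfPlane n ⊆ spinSites (-1) (glueWith Λ (fun _ => (-1 : ℤˣ)) η) ∩ halfPlane n := by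
          rintro v ⟨hv, hv1⟩
          refine ⟨?_, hv1⟩
          show glueWith Λ (fun _ => (-1 : ℤˣ)) η v = -1
          by_cases hvΛ : v ∈ Λ
          · exact glueWith_apply_mem _ _ _ hvΛ
          · rw [glueWith_apply_not_mem _ _ _ hvΛ]; exact hv
        have hz' : (siteCluster (zdGraph 2) (spinSites (-1) (glueWith Λ (fun _ => (-1 : ℤˣ)) η) ∩ halfPlane n) z).Infinite :=
          hz.mono (siteCluster_mono hsubO z)
        have hzO : z ∈ spinSites (-1) η ∩ halfPlane n := by
          obtain ⟨p, hp⟩ := hz.nonempty; exact hp.1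
        have hz1 : n ≤ z 1 := hzO.2
        have hzbox := hzN
        rw [mem_box, Fin.forall_fin_two] at hzbox
        have hz0 : |z 0| ≤ N := by rw [abs_le]; exact ⟨hzbox.1.1, hzbox.1.2⟩
        obtain ⟨p, hp⟩ := exists_walk_in_upperRect (N := N) hz0 hz1
        have hpO : ∀ v ∈ p.support, v ∈ spinSites (-1) (glueWith Λ (fun _ => (-1 : ℤˣ)) η) ∩ halfPlane n := by
          intro v hv
          obtain ⟨hv0, hv1, hv1'⟩ := hp v hv
          rw [abs_le] at hv0
          have hvΛ : v ∈ Λ := by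
            rw [hΛ, mem_box, Fin.forall_fin_two]; omega
          exact ⟨glueWith_apply_mem _ _ _ hvΛ, hv1⟩
        have hzself : z ∈ siteCluster (zdGraph 2) (spinSites (-1) (glueWith Λ (fun _ => (-1 : ℤˣ)) η) ∩ halfPlane n) z :=
          (mem_siteCluster_self_iff _ _ _).2 (by obtain ⟨q, hq⟩ := hz'.nonempty; exact hq.1)
        have h0mem : (![0, n] : Site 2) ∈ siteCluster (zdGraph 2) (spinSites (-1) (glueWith Λ (fun _ => (-1 : ℤˣ)) η) ∩ halfPlane n) z :=
          mem_siteCluster_of_walk hzself p.reverse fun v hv => hpO v (by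
            rw [Walk.support_reverse, List.mem_reverse] at hv; exact hv)
        have h0self : (![0, n] : Site 2) ∈ siteCluster (zdGraph 2) (spinSites (-1) (glueWith Λ (fun _ => (-1 : ℤˣ)) η) ∩ halfPlane n) ![0, n] :=
          (mem_siteCluster_self_iff _ _ _).2 (hpO _ (Walk.start_mem_support p))
        rw [← siteCluster_eq_of_mem h0mem h0self]
        exact hz'
      have hsub : G N ⊆ {η | glueWith Λ (fun _ => (-1 : ℤˣ)) η ∈ A 0} := by
        rintro η ⟨h1, h2⟩
        refine ⟨fun l hl hl' => glueWith_apply_mem _ _ _ ?_, hglueTop η h1, ?_⟩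
        · rw [hΛ, mem_box, Fin.forall_fin_two]; push_cast; simp; omega
        · show (siteCluster (zdGraph 2) (spinSites (-1) (ρ (glueWith Λ (fun _ => (-1 : ℤˣ)) η)) ∩ halfPlane n) ![0, n]).Infinite
          rw [hρ, hΛ, configRelabel_reflectOne_glueWith_box]
          exact hglueTop (ρ η) h2
      have key := hμG.mul_measure_glueWith_preimage_le (G := zdGraph 2) Λ (fun _ => (-1 : ℤˣ)) (hAmeas 0)
      intro hA0
      rw [hA0, nonpos_iff_eq_zero, mul_eq_zero] at key
      rcases key with h | h
      · exact (ENNReal.ofReal_pos.2 (div_pos (Real.exp_pos _) (pow_pos two_pos _))).ne' h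
      · exact hGN (measure_mono_null hsub h)
    -- Poincaré recurrence in both directions and ergodicity: `A_k` occurs for unboundedly many `k` of both signs
    set Rset : Set (SpinConfig (Site 2)) := {ω | (∀ K : ℕ, ∃ k : ℤ, (K : ℤ) < k ∧ ω ∈ A k) ∧
      (∀ K : ℕ, ∃ k : ℤ, k < -(K : ℤ) ∧ ω ∈ A k)} with hR
    have hRmeas : MeasurableSet Rset := by
      refine measurableSet_setOf.2 (Measurable.and ?_ ?_)
      · exact Measurable.forall fun K => Measurable.exists fun k =>
          Measurable.and measurable_const (measurableSet_setOf.1 (hAmeas k))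
      · exact Measurable.forall fun K => Measurable.exists fun k =>
          Measurable.and measurable_const (measurableSet_setOf.1 (hAmeas k))
    have hA0R : ∀ᵐ ω ∂μ, ω ∈ A 0 → ω ∈ Rset := by
      filter_upwards [hmp.conservative.ae_mem_imp_frequently_image_mem (hAmeas 0).nullMeasurableSet,
        hmp'.conservative.ae_mem_imp_frequently_image_mem (hAmeas 0).nullMeasurableSet] with ω h1 h2 hω
      have f1 := h1 hω
      have f2 := h2 hω
      rw [Filter.frequently_atTop] at f1 f2
      have g1 : ∀ K : ℕ, ∃ b : ℕ, K < b ∧ ω ∈ A (-((b : ℤ) * t)) := by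
        intro K
        obtain ⟨b, hb, hbA⟩ := f1 (K + 1)
        rw [hθ, configShift_single_iterate, hshift] at hbA
        exact ⟨b, by omega, by rw [zero_sub] at hbA; exact hbA⟩
      have g2 : ∀ K : ℕ, ∃ b : ℕ, K < b ∧ ω ∈ A ((b : ℤ) * t) := by
        intro K
        obtain ⟨b, hb, hbA⟩ := f2 (K + 1)
        rw [configShift_single_iterate, hshift] at hbA
        refine ⟨b, by omega, ?_⟩
        rw [zero_sub, mul_neg, neg_neg] at hbA; exact hbA
      rcases lt_or_gt_of_ne ht with hneg | hpos
      · constructor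
        · intro K
          obtain ⟨b, hb, hbA⟩ := g1 K
          exact ⟨-((b : ℤ) * t), by nlinarith, hbA⟩
        · intro K
          obtain ⟨b, hb, hbA⟩ := g2 K
          exact ⟨(b : ℤ) * t, by nlinarith, hbA⟩
      · constructor
        · intro K
          obtain ⟨b, hb, hbA⟩ := g2 K
          exact ⟨(b : ℤ) * t, by nlinarith, hbA⟩
        · intro K
          obtain ⟨b, hb, hbA⟩ := g1 K
          exact ⟨-((b : ℤ) * t), by nlinarith, hbA⟩
    have hRinv : θ ⁻¹' Rset = Rset := by
      ext ω
      simp only [Set.mem_preimage, hR, Set.mem_setOf_eq, hθ, hshift]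
      constructor
      · rintro ⟨h1, h2⟩
        refine ⟨fun K => ?_, fun K => ?_⟩
        · obtain ⟨k, hk, hkA⟩ := h1 (K + t.natAbs)
          refine ⟨k - t, ?_, hkA⟩
          push_cast at hk; rcases abs_cases t with ⟨h3, h4⟩ | ⟨h3, h4⟩ <;> omega
        · obtain ⟨k, hk, hkA⟩ := h2 (K + t.natAbs)
          refine ⟨k - t, ?_, hkA⟩
          push_cast at hk; rcases abs_cases t with ⟨h3, h4⟩ | ⟨h3, h4⟩ <;> omega
      · rintro ⟨h1, h2⟩
        refine ⟨fun K => ?_, fun K => ?_⟩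
        · obtain ⟨k, hk, hkA⟩ := h1 (K + t.natAbs)
          refine ⟨k + t, ?_, by rw [add_sub_cancel_right]; exact hkA⟩
          push_cast at hk; rcases abs_cases t with ⟨h3, h4⟩ | ⟨h3, h4⟩ <;> omega
        · obtain ⟨k, hk, hkA⟩ := h2 (K + t.natAbs)
          refine ⟨k + t, ?_, by rw [add_sub_cancel_right]; exact hkA⟩
          push_cast at hk; rcases abs_cases t with ⟨h3, h4⟩ | ⟨h3, h4⟩ <;> omega
    have hv0 : (Pi.single (0 : Fin 2) t : Site 2) ≠ 0 := by
      intro h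
      have := congrFun h 0
      simp at this
      exact ht this
    have hR1 : μ Rset = 1 := by
      rcases hμt.measure_eq_zero_or_one_of_shift_invariant hv0 hinv hRmeas hRinv with h0 | h1
      · exfalso
        apply hApos
        rw [measure_eq_zero_iff_ae_notMem] at h0 ⊢
        filter_upwards [h0, hA0R] with ω h1 h2 h3
        exact h1 (h2 h3)
      · exact h1
    have hR1ae : ∀ᵐ ω ∂μ, ω ∈ Rset := by
      have := (prob_compl_eq_zero_iff hRmeas).2 hR1
      filter_upwards [measure_eq_zero_iff_ae_notMem.1 this] with ω hω
      exact not_not.1 hω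
    -- uniqueness of the infinite `-`clusters of `{x₂ ≥ n}`, for `ω` and for `ρ ω`
    set vL : Site 2 := -((m + 1 : ℕ) : ℤ) • (Pi.single 1 1 : Site 2) with hvL
    have hvL1 : (0 : ℤ) - vL 1 = n := by rw [hvL, ← hcast]; simp
    have hTLm : Measurable (configShift (S := ℤˣ) vL : SpinConfig (Site 2) → SpinConfig (Site 2)) :=
      (configShift _).measurable
    have hinj : Function.Injective (fun z : Site 2 => z + vL) := fun a b h => add_right_cancel h
    have huniq_gen : ∀ ν : Measure (SpinConfig (Site 2)), ν ∈ isingGibbsMeasures 2 β 0 →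
        ∀ᵐ ω ∂ν, ∀ x y₁ y₂ : Site 2, (siteCluster zdStarGraph (spinSites 1 ω ∩ halfPlane n) x).Infinite →
          (siteCluster (zdGraph 2) (spinSites (-1) ω ∩ halfPlane n) y₁).Infinite →
          (siteCluster (zdGraph 2) (spinSites (-1) ω ∩ halfPlane n) y₂).Infinite →
          siteCluster (zdGraph 2) (spinSites (-1) ω ∩ halfPlane n) y₁ =
            siteCluster (zdGraph 2) (spinSites (-1) ω ∩ halfPlane n) y₂ := by
      intro ν hν
      have hνL : ν.map (configShift vL) ∈ isingGibbsMeasures 2 β 0 := mem_isingGibbsMeasures_map_configShift hν _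
      filter_upwards [ae_of_ae_map hTLm.aemeasurable (ae_minus_cluster_unique hβc hνL)] with ω hω x y₁ y₂ hx h₁ h₂
      have ix := siteCluster_configShift_eq_image_star 1 vL 0 ω x
      have i₁ := siteCluster_configShift_eq_image_lattice (-1) vL 0 ω y₁
      have i₂ := siteCluster_configShift_eq_image_lattice (-1) vL 0 ω y₂
      rw [hvL1] at ix i₁ i₂
      have key := hω (x + vL) (y₁ + vL) (y₂ + vL) (by rw [ix]; exact hx.image hinj.injOn)
        (by rw [i₁]; exact h₁.image hinj.injOn) (by rw [i₂]; exact h₂.image hinj.injOn)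
      rw [i₁, i₂] at key
      exact hinj.image_injective key
    have hDn : ∀ᵐ ω ∂μ, ∃ x, (siteCluster zdStarGraph (spinSites 1 ω ∩ halfPlane n) x).Infinite := by
      have h := shift_lemma_up_level hμ hμt 1 hP (m + 1)
      rw [hcast] at h
      filter_upwards [h] with ω ⟨x, hx⟩
      exact ⟨x, infinite_starCluster_of_latticeCluster hx⟩
    have hDnB : ∀ᵐ ω ∂μ, ∃ x, (siteCluster zdStarGraph (spinSites 1 (ρ ω) ∩ halfPlane n) x).Infinite := by
      have h := shift_lemma_up_level hμR hμRt 1 hP' (m + 1)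
      rw [hcast] at h
      filter_upwards [ae_of_ae_map hρm.aemeasurable h] with ω ⟨x, hx⟩
      exact ⟨x, infinite_starCluster_of_latticeCluster hx⟩
    -- assembling the frame
    filter_upwards [hR1ae, huniq_gen μ hμ, ae_of_ae_map hρm.aemeasurable (huniq_gen _ hμR), hDn, hDnB]
      with ω ⟨hRpos, hRneg⟩ hUT hUB ⟨xT, hxT⟩ ⟨xB, hxB⟩ u hu
    obtain ⟨k', hk', hcol', htop', hbot'⟩ := hRpos m
    obtain ⟨k, hk, hcol, htop, hbot⟩ := hRneg m
    -- the top path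
    have hself : ∀ {σ : SpinConfig (Site 2)} {z : Site 2},
        (siteCluster (zdGraph 2) (spinSites (-1) σ ∩ halfPlane n) z).Infinite →
          z ∈ siteCluster (zdGraph 2) (spinSites (-1) σ ∩ halfPlane n) z := fun h =>
      (mem_siteCluster_self_iff _ _ _).2 (by obtain ⟨p, hp⟩ := h.nonempty; exact hp.1)
    have hk'mem : (![k', n] : Site 2) ∈ siteCluster (zdGraph 2) (spinSites (-1) ω ∩ halfPlane n) ![k, n] := by
      rw [hUT xT (![k, n]) (![k', n]) hxT htop htop']; exact hself htop'
    obtain ⟨ptop, hptop⟩ := exists_walk_of_mem_siteCluster (hself htop) hk'mem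
    -- the bottom path: in `{x₂ ≥ n}` for `ρ ω`, reflected
    have hk'memB : (![k', n] : Site 2) ∈ siteCluster (zdGraph 2) (spinSites (-1) (ρ ω) ∩ halfPlane n) ![k, n] := by
      rw [hUB xB (![k, n]) (![k', n]) hxB hbot hbot']; exact hself hbot'
    obtain ⟨q, hq⟩ := exists_walk_of_mem_siteCluster (hself hbot) hk'memB
    have hRk : reflectCoord (d := 2) 1 (![k, n] : Site 2) = ![k, -n] := by
      funext i; rw [reflectCoord_apply]; fin_cases i <;> simp
    have hRk' : reflectCoord (d := 2) 1 (![k', n] : Site 2) = ![k', -n] := by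
      funext i; rw [reflectCoord_apply]; fin_cases i <;> simp
    set pbot : (zdGraph 2).Walk (![k, -n] : Site 2) ![k', -n] :=
      (q.map (reflectCoord (d := 2) 1).toRelEmbedding.toRelHom).copy hRk hRk' with hpbot_def
    have hpbot : ∀ v ∈ pbot.support, ω v = -1 ∧ v 1 ≤ -n := by
      intro v hv
      rw [hpbot_def, Walk.support_copy, Walk.support_map, List.mem_map] at hv
      obtain ⟨y, hy, rfl⟩ := hv
      obtain ⟨hy1, hy2⟩ := hq y hy
      have hy2' : n ≤ y 1 := hy2
      have hy1' : (ρ ω) y = -1 := hy1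
      rw [hρ, configRelabel_apply, reflectCoord_symm_apply] at hy1'
      show ω (reflectCoord 1 y) = -1 ∧ (reflectCoord 1 y) 1 ≤ -n
      refine ⟨hy1', ?_⟩
      have hR1 : (reflectCoord (d := 2) 1 y) 1 = -y 1 := Rf_apply_one y
      rw [hR1]; omega
    exact siteCluster_plus_finite_of_minusFrame (m := m) hk hk' hcol hcol' ptop (fun v hv => hptop v hv) pbot hpbot hu
  -- STEP B: conclusion
  rw [measure_eq_zero_iff_ae_notMem]
  filter_upwards [ae_all_iff.2 hF] with ω hω hmem
  obtain ⟨x, hx⟩ := mem_existsInfCluster_iff.1 hmem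
  set m : ℕ := max (x 0).natAbs (x 1).natAbs with hm
  have h0 : ((x 0).natAbs : ℤ) ≤ m := by exact_mod_cast le_max_left _ _
  have h1 : ((x 1).natAbs : ℤ) ≤ m := by exact_mod_cast le_max_right _ _
  exact hx (hω m x ⟨by omega, by omega, by omega, by omega⟩)

end Main

end Literature.Probability.LatticeModels
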